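import Literature.Computability.QuantumComplexity.FHKLInfluenceBoundsProofs
import Literature.Computability.QuantumComplexity.DFKOInfluenceBoundProofs
import Literature.Computability.Complexity.HypercontractivityP2
import HarnessLib

/-!
# Discharge of `FilmusEtAl2016_prop318`: `4 Var[p] ≤ ∑ᵢ Infᵢ[p] ≤ d⁴ e^{2d} / N` for transitive bounded `p`

Topic `Computability/QuantumComplexity`. This file proves the named fact
`Literature.Computability.QuantumComplexity.FilmusEtAl2016_prop318` of `FHKLInfluenceBounds.lean`
(Y. Filmus, H. Hatami, N. Keller, N. Lifshitz, *On the sum of the `L₁` influences of bounded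
functions*, Israel J. Math. 214 (2016) 167–192, Prop. 3.18, the printed clause `p = 2`:
`Var[f] ≤ Inf⁽²⁾[f] ≤ d⁴ e^{2d}/n` for a transitive-invariant `f : {-1,1}ⁿ → [-1,1]` of degree `d`)
as `FilmusEtAl2016_prop318_holds`, in the tree's dictionary `f = 2p - 1` (module docstring of
`FHKLInfluenceBounds.lean`: `f_i = D_i p := p - p ∘ flip_i`, `Inf⁽²⁾_i[f] = influence i p`,
`Inf⁽¹⁾_i[f] = E|D_i p|`, `Var f = 4 Var p`).

## The printed proof and what is formalized

Printed proof (loc. cit., §3.5): the influences of a transitive-invariant function are all equal;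
by hypercontractivity `‖f_i‖₂ ≤ e^d ‖f_i‖₁`, so `Inf⁽ᵖ⁾_i ≤ e^{pd} (Inf_i)^p`; by Thm. 3.3
(`Inf[f] ≤ d²`) and symmetry `Inf_i ≤ d²/n`; sum over `i`. "In particular
`Var[f] ≤ Inf⁽²⁾[f]`" is the Poincaré inequality. The same steps here:

1. `FHKL.four_mul_boolVariance_le_sum_influence` — Poincaré, `4 Var[p] = 4 ∑_{S≠∅} p̂(S)² ≤
   4 ∑_S |S| p̂(S)² = ∑_i Inf_i[p]` (`sum_influence_eq`, `boolVariance_eq_tailWeight_one`).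
2. Thm. 3.3, `∑_i E|D_i p| ≤ d²`, is the tree's `FilmusEtAl2016_thm33_holds`
   (`FHKLInfluenceBoundsProofs.lean`, the sharp `d²` via the corner Markov inequality).
3. `FHKL.sum_congr_of_perm`, `FHKL.boolAvg_eq_of_transitive` — transitivity: if `p ∘ σ = p` then
   the `D_i`-statistics at `i` and `σ i` agree; hence all `influence i p` are equal and all
   `E|D_i p|` are equal (`= 1/N` of the respective sums).
4. `FHKL.boolAvg_sq_le_exp_mul_sq` — hypercontractivity: `x ↦ χ_i(x) D_i p(x)` has the same
   absolute value as `D_i p` and Fourier degree `≤ d - 1`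
   (`FHKL.cubeFourierCoeff_sgn_mul_sub_flipBit_eq_zero`; in print `f_i = x_i ∂_i f`), so the
   reverse Hölder inequality with base `e`,
   `Literature.Computability.Complexity.LowDegree.avg_sq_le_exp_mul_sq_avg_abs` (from the
   `(p,2)`-hypercontractivity theorem, `HypercontractivityP2.lean`; O'Donnell 2014, Thm. 9.22 at a
   fixed exponent) gives `Inf_i[p] ≤ e^{2(d-1)+1/2} (E|D_i p|)²`. Print uses `deg f_i ≤ d` and the
   sharp constant `e^d`; the degree `d - 1` absorbs the `e^{1/2}` of the fixed-exponent version: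
   `e^{2d - 3/2} ≤ e^{2d}`.
5. Assembly (`FilmusEtAl2016_prop318_holds`): `∑_i Inf_i = N · Inf_{i₀} ≤ N e^{2d-3/2}(d²/N)² ≤
   d⁴ e^{2d}/N`; the cases `N = 0`, `d = 0` are trivial.

## References

* [FilmusEtAl2016] Y. Filmus, H. Hatami, N. Keller, N. Lifshitz, Israel J. Math. 214 (2016)
  167–192 = arXiv:1404.3396 — Prop. 3.18 and its proof (§3.5), Thm. 3.3 (§3.1), §2 (definition
  of `f_i = x_i ∂f/∂x_i`) (arXiv text read, pp. 5–6, 10).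
* [ODonnell2014] R. O'Donnell, *Analysis of Boolean Functions*, CUP 2014 — §2.2 (influences in the
  Fourier basis), Ch. 9 ((p,2)-hypercontractivity, Thm. 9.22).
-/

noncomputable section

namespace Literature.Computability.QuantumComplexity

namespace FHKL

open Finset Literature.Computability.Complexity.LowDegree
  Literature.Probability.RandomGraphs.LowDegree

variable {N : ℕ}

/-! ### Step 1: Poincaré -/

/-- **Poincaré inequality** in the tree's normalisation: `4 Var[p] ≤ ∑_i Inf_i[p]`
(`4 ∑_{S ≠ ∅} p̂(S)² ≤ 4 ∑_S |S| p̂(S)²`; "In particular, `Var[f] ≤ Inf⁽²⁾[f]`").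
[cite: FilmusEtAl2016, Prop. 3.18] -/
theorem four_mul_boolVariance_le_sum_influence (p : MvPolynomial (Fin N) ℝ) :
    4 * boolVariance p ≤ ∑ i, influence i p := by
  rw [sum_influence_eq, boolVariance_eq_tailWeight_one, tailWeight]
  refine mul_le_mul_of_nonneg_left ?_ (by norm_num)
  calc ∑ S ∈ univ.filter (fun S : Finset (Fin N) => 1 ≤ S.card), cubeFourierCoeff (evalBool p) S ^ 2
      ≤ ∑ S ∈ univ.filter (fun S : Finset (Fin N) => 1 ≤ S.card),
          (S.card : ℝ) * cubeFourierCoeff (evalBool p) S ^ 2 :=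
        sum_le_sum fun S hS =>
          le_mul_of_one_le_left (sq_nonneg _) (by exact_mod_cast (mem_filter.1 hS).2)
    _ ≤ ∑ S, (S.card : ℝ) * cubeFourierCoeff (evalBool p) S ^ 2 :=
        sum_le_sum_of_subset_of_nonneg (filter_subset _ _) fun S _ _ => by positivity

/-! ### Step 3: transitivity -/

/-- Flipping bit `i` after permuting coordinates by `σ` is permuting after flipping bit `σ i`.
[folklore] -/
theorem flipBit_comp_perm (σ : Equiv.Perm (Fin N)) (i : Fin N) (x : Fin N → Bool) :
    flipBit i (fun k => x (σ k)) = fun k => flipBit (σ i) x (σ k) := by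
  funext k
  unfold flipBit
  by_cases hk : k = i
  · subst hk
    simp
  · have hσk : σ k ≠ σ i := fun h => hk (σ.injective h)
    simp [Function.update_of_ne hk, Function.update_of_ne hσk]

/-- **Symmetry transports one-coordinate statistics**: if `g` is invariant under the coordinate
permutation `σ`, then for any `H`, `∑_x H(g(x), g(x ⊕ e_{σ i})) = ∑_x H(g(x), g(x ⊕ e_i))`.
[cite: FilmusEtAl2016, §3.5 ("the influences are all equal")] -/
theorem sum_congr_of_perm {g : (Fin N → Bool) → ℝ} (σ : Equiv.Perm (Fin N))
    (hσ : ∀ x : Fin N → Bool, g (fun k => x (σ k)) = g x) (H : ℝ → ℝ → ℝ) (i : Fin N) :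
    ∑ x : Fin N → Bool, H (g x) (g (flipBit (σ i) x)) =
      ∑ x : Fin N → Bool, H (g x) (g (flipBit i x)) := by
  -- reindex the right-hand sum by `x ↦ x ∘ σ`
  set e : (Fin N → Bool) ≃ (Fin N → Bool) := Equiv.arrowCongr σ.symm (Equiv.refl Bool) with he
  have heq : ∀ x : Fin N → Bool, e x = fun k => x (σ k) := fun x => by
    funext k
    simp [he, Equiv.arrowCongr_apply]
  refine Fintype.sum_equiv e _ _ fun z => ?_
  rw [heq, flipBit_comp_perm, hσ, hσ]

/-- Consequently all influences of a transitive-invariant `p` are equal (and likewise the `L¹`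
influences). [cite: FilmusEtAl2016, §3.5] -/
theorem boolAvg_eq_of_transitive {p : MvPolynomial (Fin N) ℝ}
    (ht : ∀ i j : Fin N, ∃ σ : Equiv.Perm (Fin N), σ i = j ∧
      ∀ x : Fin N → Bool, evalBool p (fun k => x (σ k)) = evalBool p x)
    (H : ℝ → ℝ → ℝ) (i j : Fin N) :
    boolAvg (fun x => H (evalBool p x) (evalBool p (flipBit i x))) =
      boolAvg (fun x => H (evalBool p x) (evalBool p (flipBit j x))) := by
  obtain ⟨σ, hσi, hσ⟩ := ht i j
  unfold boolAvg
  rw [← hσi, sum_congr_of_perm σ hσ H i]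

/-! ### Step 4: hypercontractivity for `χ_i · D_i g` (degree `d - 1`) -/

/-- `χ_S(x ⊕ e_i) = -χ_S(x)` if `i ∈ S`, `= χ_S(x)` otherwise (restated for a general function on
the cube; `walsh_flipBit` of `InfluenceBounds.lean`). The difference `g(x) - g(x ⊕ e_i)` in the
Walsh basis: `∑_{S ∋ i} 2 ĝ(S) χ_S(x)`. [cite: ODonnell2014, §2.2] -/
theorem sub_flipBit_eq_sum (g : (Fin N → Bool) → ℝ) (i : Fin N) (x : Fin N → Bool) :
    g x - g (flipBit i x) =
      ∑ S : Finset (Fin N), (if i ∈ S then 2 * cubeFourierCoeff g S else 0) * walsh S x := by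
  conv_lhs => rw [← sum_cubeFourierCoeff_mul_walsh g x, ← sum_cubeFourierCoeff_mul_walsh g (flipBit i x)]
  rw [← Finset.sum_sub_distrib]
  refine Finset.sum_congr rfl fun S _ => ?_
  rw [walsh_flipBit]
  split_ifs <;> ring

/-- The coefficients of `D_i g = g - g ∘ flip_i`: `2 ĝ(S)` for `S ∋ i`, `0` otherwise. [cite: ODonnell2014, §2.2] -/
theorem cubeFourierCoeff_sub_flipBit (g : (Fin N → Bool) → ℝ) (i : Fin N) (S : Finset (Fin N)) :
    cubeFourierCoeff (fun x => g x - g (flipBit i x)) S =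
      if i ∈ S then 2 * cubeFourierCoeff g S else 0 := by
  have h : (fun x => g x - g (flipBit i x)) =
      fun x => ∑ T : Finset (Fin N), (if i ∈ T then 2 * cubeFourierCoeff g T else 0) * walsh T x := by
    funext x; exact sub_flipBit_eq_sum g i x
  rw [h, cubeFourierCoeff_sum_mul_walsh]

/-- Multiplying by `χ_i` shifts the index set by `i`: `χ_i χ_S = χ_{S ∖ i}` (`i ∈ S`) or
`χ_{S ∪ i}` (`i ∉ S`). [folklore] -/
theorem sgn_mul_walsh (i : Fin N) (S : Finset (Fin N)) (x : Fin N → Bool) :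
    sgn (x i) * walsh S x = if i ∈ S then walsh (S.erase i) x else walsh (insert i S) x := by
  split_ifs with hi
  · rw [walsh, walsh, ← Finset.mul_prod_erase S (fun j => sgn (x j)) hi, ← mul_assoc, sgn_mul_self,
      one_mul]
  · rw [walsh, walsh, Finset.prod_insert hi]

/-- **`χ_i · D_i g` has Fourier degree `≤ d - 1`** when `g` has degree `≤ d`: its coefficient at
`S` is `D̂_i g (S △ {i})`, which vanishes unless `i ∉ S` and `|S ∪ {i}| ≤ d`. (In print:
`f_i = x_i ∂_i f` with `deg ∂_i f ≤ d - 1`.) [cite: FilmusEtAl2016, §2 (definition of `f_i`)] -/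
theorem cubeFourierCoeff_sgn_mul_sub_flipBit_eq_zero {g : (Fin N → Bool) → ℝ} {d : ℕ}
    (hdeg : ∀ S : Finset (Fin N), d < S.card → cubeFourierCoeff g S = 0) (i : Fin N)
    {S : Finset (Fin N)} (hS : d - 1 < S.card) :
    cubeFourierCoeff (fun x => sgn (x i) * (g x - g (flipBit i x))) S = 0 := by
  unfold cubeFourierCoeff
  have key : ∀ x : Fin N → Bool, sgn (x i) * (g x - g (flipBit i x)) * walsh S x =
      (g x - g (flipBit i x)) * (if i ∈ S then walsh (S.erase i) x else walsh (insert i S) x) := by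
    intro x
    rw [← sgn_mul_walsh]
    ring
  simp_rw [key]
  by_cases hi : i ∈ S
  · simp_rw [if_pos hi]
    have h := cubeFourierCoeff_sub_flipBit g i (S.erase i)
    unfold cubeFourierCoeff at h
    rw [h, if_neg (Finset.notMem_erase i S)]
  · simp_rw [if_neg hi]
    have h := cubeFourierCoeff_sub_flipBit g i (insert i S)
    have h2 : cubeFourierCoeff g (insert i S) = 0 :=
      hdeg _ (by rw [Finset.card_insert_of_notMem hi]; omega)
    unfold cubeFourierCoeff at h h2
    rw [h, if_pos (Finset.mem_insert_self i S), h2, mul_zero]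

/-- **Hypercontractive comparison of the `L²` and `L¹` influences**: for `g` of Fourier degree
`≤ d` with `d ≥ 1`, `E[(D_i g)²] ≤ e^{2d - 3/2} (E|D_i g|)²` (reverse Hölder
`avg_sq_le_exp_mul_sq_avg_abs` for `χ_i D_i g`, degree `d - 1`; print: `‖f_i‖₂ ≤ e^d ‖f_i‖₁`).
[cite: FilmusEtAl2016, Prop. 3.18 (proof: "By hypercontractivity, ‖f_i‖₂ ≤ e^d ‖f_i‖₁")] -/
theorem boolAvg_sq_le_exp_mul_sq {g : (Fin N → Bool) → ℝ} {d : ℕ} (hd : 1 ≤ d)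
    (hdeg : ∀ S : Finset (Fin N), d < S.card → cubeFourierCoeff g S = 0) (i : Fin N) :
    boolAvg (fun x => (g x - g (flipBit i x)) ^ 2) ≤
      Real.exp (2 * d - 3 / 2) * boolAvg (fun x => |g x - g (flipBit i x)|) ^ 2 := by
  have h := avg_sq_le_exp_mul_sq_avg_abs (d - 1) (fun x => sgn (x i) * (g x - g (flipBit i x)))
    (fun S hS => cubeFourierCoeff_sgn_mul_sub_flipBit_eq_zero hdeg i hS)
  have hsq : ∀ x : Fin N → Bool, (sgn (x i) * (g x - g (flipBit i x))) ^ 2 = (g x - g (flipBit i x)) ^ 2 := by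
    intro x; rw [mul_pow]; cases x i <;> simp [sgn]
  have habs : ∀ x : Fin N → Bool, |sgn (x i) * (g x - g (flipBit i x))| = |g x - g (flipBit i x)| := by
    intro x; rw [abs_mul]; cases x i <;> simp [sgn]
  simp_rw [hsq, habs] at h
  have hcast : (2 * ((d - 1 : ℕ) : ℝ) + 1 / 2) = 2 * (d : ℝ) - 3 / 2 := by
    rw [Nat.cast_sub hd]; push_cast; ring
  rw [hcast] at h
  exact h

end FHKL

/-! ### Step 5: the discharge -/

open Finset Literature.Computability.Complexity.LowDegree Literature.Probability.RandomGraphs.LowDegree in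
/-- **Discharge of `FilmusEtAl2016_prop318`** (Filmus–Hatami–Keller–Lifshitz 2016, Prop. 3.18,
clause `p = 2`): for a real polynomial `p` of total degree `≤ d` with `0 ≤ p ≤ 1` on `{0,1}^N`,
transitive-invariant under coordinate permutations, `4 Var[p] ≤ ∑_i Inf_i[p] ≤ d⁴ e^{2d} / N`.
Proof: steps 1–5 of the module docstring (Poincaré; Thm. 3.3 = `FilmusEtAl2016_thm33_holds`;
equal influences; reverse Hölder with base `e` for `χ_i D_i p` of degree `d - 1`).
[cite: FilmusEtAl2016, Prop. 3.18] -/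
theorem FilmusEtAl2016_prop318_holds : FilmusEtAl2016_prop318 := by
  intro N d p hp hb ht
  refine ⟨FHKL.four_mul_boolVariance_le_sum_influence p, ?_⟩
  have hdeg : ∀ S : Finset (Fin N), d < S.card → cubeFourierCoeff (evalBool p) S = 0 :=
    fun S hS => cubeFourierCoeff_evalBool_eq_zero hp hS
  -- trivial sizes
  rcases Nat.eq_zero_or_pos N with hN | hN
  · subst hN
    simp
  rcases Nat.eq_zero_or_pos d with hd | hd
  · -- degree `0`: every influence vanishes
    subst hd
    have hinf : ∀ i : Fin N, influence i p = 0 := by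
      intro i
      rw [influence_eq_sum_sq_fourier]
      simp only [mul_eq_zero, OfNat.ofNat_ne_zero, false_or]
      refine Finset.sum_eq_zero fun S hS => ?_
      rw [hdeg S (Finset.card_pos.2 ⟨i, (Finset.mem_filter.1 hS).2⟩), zero_pow two_ne_zero]
    simp [hinf]
  -- the main case `N ≥ 1`, `d ≥ 1`
  set i₀ : Fin N := ⟨0, hN⟩ with hi₀
  set I : ℝ := influence i₀ p with hI
  set L : ℝ := boolAvg (fun x => |evalBool p x - evalBool p (flipBit i₀ x)|) with hL
  have hL0 : 0 ≤ L := boolAvg_nonneg fun _ => abs_nonneg _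
  -- step 3: all influences equal `I`, all `L¹` influences equal `L`
  have hIeq : ∀ i, influence i p = I := fun i => by
    rw [hI]
    unfold influence
    exact FHKL.boolAvg_eq_of_transitive ht (fun a b => (a - b) ^ 2) i i₀
  have hLeq : ∀ i, boolAvg (fun x => |evalBool p x - evalBool p (flipBit i x)|) = L := fun i => by
    rw [hL]
    exact FHKL.boolAvg_eq_of_transitive ht (fun a b => |a - b|) i i₀
  have hsumI : ∑ i, influence i p = N * I := by
    rw [Finset.sum_congr rfl fun i _ => hIeq i, Finset.sum_const, Finset.card_univ,
      Fintype.card_fin, nsmul_eq_mul]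
  -- step 2: Thm. 3.3, `N L ≤ d²`
  have hNL : (N : ℝ) * L ≤ (d : ℝ) ^ 2 := by
    have h := FilmusEtAl2016_thm33_holds N d p hp hb
    rwa [Finset.sum_congr rfl fun i _ => hLeq i, Finset.sum_const, Finset.card_univ,
      Fintype.card_fin, nsmul_eq_mul] at h
  have hNpos : (0 : ℝ) < N := by exact_mod_cast hN
  have hN0 : (N : ℝ) ≠ 0 := hNpos.ne'
  have hLle : L ≤ (d : ℝ) ^ 2 / N := by
    rw [le_div_iff₀ hNpos]; linarith
  -- step 4: hypercontractivity, `I ≤ e^{2d-3/2} L²`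
  have hIle : I ≤ Real.exp (2 * d - 3 / 2) * L ^ 2 := by
    rw [hI, hL]
    unfold influence
    exact FHKL.boolAvg_sq_le_exp_mul_sq hd hdeg i₀
  -- step 5: assembly
  have hexp : Real.exp (2 * d - 3 / 2) ≤ Real.exp (2 * d) := Real.exp_le_exp.2 (by linarith)
  calc ∑ i, influence i p = N * I := hsumI
    _ ≤ N * (Real.exp (2 * d - 3 / 2) * L ^ 2) := mul_le_mul_of_nonneg_left hIle hNpos.le
    _ ≤ N * (Real.exp (2 * d) * ((d : ℝ) ^ 2 / N) ^ 2) := by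
        gcongr
    _ = (d : ℝ) ^ 4 * Real.exp (2 * d) / N := by
        field_simp

end Literature.Computability.QuantumComplexity

end
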